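import Summits.Ventures.PercRepro.PuncturedLYMTwoCoHypSeq

/-!
# PercRepro — TWO DISJOINT CO-HYPERPLANES, PART 4: THE BOUNDARY CORRECTION OF LAYER 1 IN CLOSED FORM (p10, gen 34)

Arithmetic only.  Layer 1 = the rows `(m₁ − 1, b, e)` one point short of `C₁` (`e = L − b`, `L = j + 1 − m₁`,
`ρ = n − m₁ − m₂`).  With `N_b = C(m₂, b)·C(ρ, L − b)` (the rows of level `b` = the touched columns `(m₁, b)`),
`α_b = twoK/m₁ − supA (m₁ − 1) b` (what the `+A` edge must change by so that the touched column sums to `twoK`),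
`S_b = Σ_{b' ≤ b} N_{b'} α_{b'}` (the cumulative sink), the correction is
`β_b = −S_b/(N_b (m₂ − b))` on the `+B` edges and `γ_b = S_{b−1}/(N_b (ρ − L + b))` on the `+R` edges (`γ_0 = 0`):
* `bS_succ` — `S_{b+1} = S_b + N_{b+1} α_{b+1}`;
* **`layer_row`** — the corrected row at level `b` sums to `1` (for `N_b ≠ 0`);
* **`layer_col`** — the corrected untouched column `(m₁ − 1, b', L − b' + 1)` sums to `twoK` for `1 ≤ b'`
  (`N_{b'−1}, N_{b'} ≠ 0`, `b' ≤ m₂ − 1`, `b' ≤ L`): the ratio identity `b'·N_{b'}·(ρ − L + b') = (m₂ − b' + 1)(L − b' + 1)·N_{b'−1}`;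
* `layer_col_zero` — the column at level `0` (no `+B` contribution, `γ_0 = 0`).
The corner row / column and the zero-sum `S_{m₂−1} = 0` (proofs/P10-BOUNDARY-g34.md §2′) are NOT here; nothing asserts
(SP), (PAV) or (NC).
-/

namespace PercRepro.PuncturedLYM

open Finset

/-- `N_b = C(m₂, b)·C(n − m₁ − m₂, j + 1 − m₁ − b)`. -/
def bN (n j m₁ m₂ b : ℕ) : ℕ := m₂.choose b * (n - m₁ - m₂).choose (j + 1 - m₁ - b)

/-- `α_b = twoK/m₁ − supA (m₁ − 1) b`. -/
def bAlpha (n j m₁ m₂ b : ℕ) : ℚ := twoK n j m₁ m₂ / (m₁ : ℚ) - supA n j m₁ m₂ (m₁ - 1) b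

/-- `S_b = Σ_{b' ≤ b} N_{b'}·α_{b'}`. -/
def bS (n j m₁ m₂ b : ℕ) : ℚ := ∑ b' ∈ range (b + 1), (bN n j m₁ m₂ b' : ℚ) * bAlpha n j m₁ m₂ b'

/-- `β_b = −S_b/(N_b·(m₂ − b))`. -/
def bBeta (n j m₁ m₂ b : ℕ) : ℚ := -bS n j m₁ m₂ b / ((bN n j m₁ m₂ b : ℚ) * ((m₂ - b : ℕ) : ℚ))

/-- `ρ − L + b = n − j − 1 − m₂ + b`. -/
def bRho (n j m₂ b : ℕ) : ℕ := n - j - 1 - m₂ + b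

/-- `γ_b = S_{b−1}/(N_b·(ρ − L + b))` for `b ≥ 1`, `γ_0 = 0`. -/
def bGamma (n j m₁ m₂ b : ℕ) : ℚ :=
  if b = 0 then 0 else bS n j m₁ m₂ (b - 1) / ((bN n j m₁ m₂ b : ℚ) * (bRho n j m₂ b : ℚ))

/-- `S_{b+1} = S_b + N_{b+1}·α_{b+1}`. -/
theorem bS_succ (n j m₁ m₂ b : ℕ) :
    bS n j m₁ m₂ (b + 1) = bS n j m₁ m₂ b + (bN n j m₁ m₂ (b + 1) : ℚ) * bAlpha n j m₁ m₂ (b + 1) := by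
  unfold bS
  rw [sum_range_succ]

/-- `S_0 = N_0·α_0`. -/
theorem bS_zero (n j m₁ m₂ : ℕ) : bS n j m₁ m₂ 0 = (bN n j m₁ m₂ 0 : ℚ) * bAlpha n j m₁ m₂ 0 := by
  unfold bS
  rw [sum_range_one]

/-- **The corrected row of layer 1 at level `b` sums to `1`**: `twoK/m₁ + (m₂ − b)(supB + β_b) + (ρ − L + b)(supR + γ_b) = 1`
(`b < m₂`, `N_b ≠ 0`, `ρ − L + b ≠ 0` when `b ≥ 1`). -/
theorem layer_row {n j m₁ m₂ b : ℕ} (hm₁ : 1 ≤ m₁) (hm₁j : m₁ ≤ j) (hm₂ : 1 ≤ m₂) (hm₂j : m₂ ≤ j)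
    (hn : 2 * j + 1 ≤ n) (hb : b < m₂) (hN : bN n j m₁ m₂ b ≠ 0) (hrho : b ≠ 0 → bRho n j m₂ b ≠ 0) :
    twoK n j m₁ m₂ / (m₁ : ℚ) +
      ((m₂ : ℚ) - b) * (supB n j m₁ m₂ (m₁ - 1) b + bBeta n j m₁ m₂ b) +
      (bRho n j m₂ b : ℚ) * (supR n j m₁ m₂ (m₁ - 1) b + bGamma n j m₁ m₂ b) = 1 := by
  have hrow := sup_row hm₁ hm₁j hm₂ hm₂j hn (a := m₁ - 1) (b := b) (by omega) hb
  have hcoef : ((n : ℚ) - j - m₁ - m₂ + ((m₁ - 1 : ℕ) : ℚ) + b) = (bRho n j m₂ b : ℚ) := by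
    unfold bRho
    rw [Nat.cast_sub hm₁]
    push_cast [show n - j - 1 - m₂ + b = n - (j + 1 + m₂) + b by omega,
      Nat.cast_sub (show j + 1 + m₂ ≤ n by omega)]
    ring
  rw [hcoef] at hrow
  have hNq : (bN n j m₁ m₂ b : ℚ) ≠ 0 := by exact_mod_cast hN
  have hmb : ((m₂ - b : ℕ) : ℚ) ≠ 0 := by
    have : 0 < m₂ - b := by omega
    exact_mod_cast this.ne'
  have hmbq : ((m₂ : ℚ) - b) = ((m₂ - b : ℕ) : ℚ) := by rw [Nat.cast_sub hb.le]
  -- the correction sums to zero: α_b + (m₂ − b)β_b + (ρ − L + b)γ_b = 0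
  have hcorr : bAlpha n j m₁ m₂ b + ((m₂ : ℚ) - b) * bBeta n j m₁ m₂ b +
      (bRho n j m₂ b : ℚ) * bGamma n j m₁ m₂ b = 0 := by
    unfold bBeta bGamma
    rcases Nat.eq_zero_or_pos b with h0 | h0
    · subst h0
      rw [if_pos rfl, mul_zero, add_zero, bS_zero, hmbq]
      field_simp
      ring
    · rw [if_neg h0.ne']
      have hr : (bRho n j m₂ b : ℚ) ≠ 0 := by exact_mod_cast hrho h0.ne'
      obtain ⟨b', rfl⟩ : ∃ b', b = b' + 1 := ⟨b - 1, by omega⟩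
      rw [Nat.add_sub_cancel, bS_succ, hmbq]
      field_simp
      ring
  unfold bAlpha at hcorr
  have hm1 : ((m₁ - 1 : ℕ) : ℚ) = (m₁ : ℚ) - 1 := by
    rw [Nat.cast_sub hm₁]
    push_cast
    ring
  linear_combination hrow + hcorr + (supA n j m₁ m₂ (m₁ - 1) b) * hm1

/-- The binomial ratio identity behind the column sums: `b'·N_{b'}·(ρ − L + b') = (m₂ − b' + 1)·(L − b' + 1)·N_{b'−1}`
for `1 ≤ b' ≤ m₂`, `b' ≤ L = j + 1 − m₁`. -/
theorem bN_ratio {n j m₁ m₂ b' : ℕ} (hm₁j : m₁ ≤ j) (hm₂j : m₂ ≤ j) (hn : 2 * j + 1 ≤ n) (hb1 : 1 ≤ b')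
    (hb : b' ≤ m₂) (hbL : b' ≤ j + 1 - m₁) :
    b' * bN n j m₁ m₂ b' * bRho n j m₂ b' = (m₂ - b' + 1) * (j + 1 - m₁ - b' + 1) * bN n j m₁ m₂ (b' - 1) := by
  obtain ⟨c, rfl⟩ : ∃ c, b' = c + 1 := ⟨b' - 1, by omega⟩
  unfold bN bRho
  rw [Nat.add_sub_cancel]
  have e1 : m₂.choose (c + 1) * (c + 1) = m₂.choose c * (m₂ - c) := Nat.choose_succ_right_eq m₂ c
  have hk : j + 1 - m₁ - (c + 1) + 1 = j + 1 - m₁ - c := by omega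
  have e2 : (n - m₁ - m₂).choose (j + 1 - m₁ - c) * (j + 1 - m₁ - c) =
      (n - m₁ - m₂).choose (j + 1 - m₁ - (c + 1)) * (n - m₁ - m₂ - (j + 1 - m₁ - (c + 1))) := by
    have := Nat.choose_succ_right_eq (n - m₁ - m₂) (j + 1 - m₁ - (c + 1))
    rw [hk] at this
    exact this
  have hrho : n - j - 1 - m₂ + (c + 1) = n - m₁ - m₂ - (j + 1 - m₁ - (c + 1)) := by omega
  have hmc : m₂ - (c + 1) + 1 = m₂ - c := by omega
  rw [hrho, hmc, hk]
  calc (c + 1) * (m₂.choose (c + 1) * (n - m₁ - m₂).choose (j + 1 - m₁ - (c + 1))) *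
        (n - m₁ - m₂ - (j + 1 - m₁ - (c + 1)))
      = (m₂.choose (c + 1) * (c + 1)) *
          ((n - m₁ - m₂).choose (j + 1 - m₁ - (c + 1)) * (n - m₁ - m₂ - (j + 1 - m₁ - (c + 1)))) := by ring
    _ = (m₂.choose c * (m₂ - c)) * ((n - m₁ - m₂).choose (j + 1 - m₁ - c) * (j + 1 - m₁ - c)) := by rw [e1, e2]
    _ = (m₂ - c) * (j + 1 - m₁ - c) * (m₂.choose c * (n - m₁ - m₂).choose (j + 1 - m₁ - c)) := by ring

/-- **The corrected untouched column of layer 1 at level `b' ≥ 1` sums to `twoK`**: the column `(m₁ − 1, b', L − b' + 1)`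
receives `+A` from the interior row `(m₁ − 2, b')`, `+B` from the layer-1 row `(m₁ − 1, b' − 1)` and `+R` from the
layer-1 row `(m₁ − 1, b')`. -/
theorem layer_col {n j m₁ m₂ b' : ℕ} (hm₁ : 1 ≤ m₁) (hm₁j : m₁ ≤ j) (hm₂ : 1 ≤ m₂) (hm₂j : m₂ ≤ j)
    (hn : 2 * j + 1 ≤ n) (hb1 : 1 ≤ b') (hb : b' < m₂) (hbL : b' ≤ j + 1 - m₁)
    (hN : bN n j m₁ m₂ b' ≠ 0) (hN' : bN n j m₁ m₂ (b' - 1) ≠ 0) (hrho : bRho n j m₂ b' ≠ 0) :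
    ((m₁ - 1 : ℕ) : ℚ) * supA n j m₁ m₂ (m₁ - 1 - 1) b' +
      (b' : ℚ) * (supB n j m₁ m₂ (m₁ - 1) (b' - 1) + bBeta n j m₁ m₂ (b' - 1)) +
      ((j : ℚ) + 1 - ((m₁ - 1 : ℕ) : ℚ) - b') * (supR n j m₁ m₂ (m₁ - 1) b' + bGamma n j m₁ m₂ b') =
      twoK n j m₁ m₂ := by
  have hcol := sup_col hm₁ hm₁j hm₂ hm₂j hn (a' := m₁ - 1) (b' := b') (by omega) hb
  have hcorr : (b' : ℚ) * bBeta n j m₁ m₂ (b' - 1) +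
      ((j : ℚ) + 1 - ((m₁ - 1 : ℕ) : ℚ) - b') * bGamma n j m₁ m₂ b' = 0 := by
    unfold bBeta bGamma
    rw [if_neg (by omega)]
    have hNq : (bN n j m₁ m₂ b' : ℚ) ≠ 0 := by exact_mod_cast hN
    have hNq' : (bN n j m₁ m₂ (b' - 1) : ℚ) ≠ 0 := by exact_mod_cast hN'
    have hrq : (bRho n j m₂ b' : ℚ) ≠ 0 := by exact_mod_cast hrho
    have hmb : ((m₂ - (b' - 1) : ℕ) : ℚ) ≠ 0 := by
      have : 0 < m₂ - (b' - 1) := by omega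
      exact_mod_cast this.ne'
    have hratio := bN_ratio hm₁j hm₂j hn hb1 hb.le hbL
    have hratioq : (b' : ℚ) * (bN n j m₁ m₂ b' : ℚ) * (bRho n j m₂ b' : ℚ) =
        ((m₂ - (b' - 1) : ℕ) : ℚ) * ((j + 1 - m₁ - b' + 1 : ℕ) : ℚ) * (bN n j m₁ m₂ (b' - 1) : ℚ) := by
      have : m₂ - (b' - 1) = m₂ - b' + 1 := by omega
      rw [this]
      exact_mod_cast hratio
    have hcoef : ((j : ℚ) + 1 - ((m₁ - 1 : ℕ) : ℚ) - b') = ((j + 1 - m₁ - b' + 1 : ℕ) : ℚ) := by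
      rw [Nat.cast_sub hm₁]
      push_cast [show j + 1 - m₁ - b' + 1 = j + 2 - (m₁ + b') by omega,
        Nat.cast_sub (show m₁ + b' ≤ j + 2 by omega)]
      ring
    have key : (b' : ℚ) / ((bN n j m₁ m₂ (b' - 1) : ℚ) * ((m₂ - (b' - 1) : ℕ) : ℚ)) =
        ((j + 1 - m₁ - b' + 1 : ℕ) : ℚ) / ((bN n j m₁ m₂ b' : ℚ) * (bRho n j m₂ b' : ℚ)) := by
      rw [div_eq_div_iff (mul_ne_zero hNq' hmb) (mul_ne_zero hNq hrq)]
      linear_combination hratioq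
    rw [hcoef]
    calc (b' : ℚ) * (-bS n j m₁ m₂ (b' - 1) / ((bN n j m₁ m₂ (b' - 1) : ℚ) * ((m₂ - (b' - 1) : ℕ) : ℚ))) +
          ((j + 1 - m₁ - b' + 1 : ℕ) : ℚ) *
            (bS n j m₁ m₂ (b' - 1) / ((bN n j m₁ m₂ b' : ℚ) * (bRho n j m₂ b' : ℚ)))
        = bS n j m₁ m₂ (b' - 1) *
            (-((b' : ℚ) / ((bN n j m₁ m₂ (b' - 1) : ℚ) * ((m₂ - (b' - 1) : ℕ) : ℚ))) +
              ((j + 1 - m₁ - b' + 1 : ℕ) : ℚ) / ((bN n j m₁ m₂ b' : ℚ) * (bRho n j m₂ b' : ℚ))) := by ring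
      _ = 0 := by rw [key]; ring
  linear_combination hcol + hcorr

end PercRepro.PuncturedLYM
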